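import Mathlib
import HarnessLib
import Summits.Ventures.LatticeQCDFlow.Exactness.JarzynskiEstimatorBias

/-!
# Linearisation lemmas for the root of the sample Bennett equation

HONEST FRAMING: exact (Metropolis-corrected) sampling algorithms for lattice gauge theory;
figures of merit are autocorrelation/cost numbers at stated couplings and volumes; no
continuum-physics claim.

Venture `LatticeQCDFlow` (cell pub-lqcd), topic `Exactness`; FANOUT row 13 (`eng-snf`, GEN-15).
NEW WORK of the cell (one-variable real analysis: the mean value inequality on a segment, the Fermi
function), not a published result; nothing is cited as a fact.  Deterministic half of the central
limit theorem of the self-consistent Bennett (BAR) estimate (`NCMCGeneralSpaceBennettRootCLT.lean`):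
what makes a root of a MONOTONE estimating equation linearisable without derivatives at random
points is a pointwise Taylor bound with a Lipschitz derivative, summed over the sample, plus one
real-variable inequality turning "`|ḡ + A Δ| ≤ Δ²/2`, `A ≈ κ`, `Δ ≈ 0`" into "`Δ/ḡ ≈ −1/κ`".

## Content (`σ = Real.sigmoid`, `σ' = σ(1 − σ)`; one pair contributes `ψ_d = σ(d − a) − σ(b − d)`,
`a` the forward work, `b` the work read on the reverse record; `φ_d = σ'(d − a) + σ'(b − d)`)

* **`abs_sub_sub_deriv_mul_le`** — Taylor with a Lipschitz derivative on the line: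
  `|f d' − f d − f' d (d' − d)| ≤ L (d' − d)²` if `f'` is `L`-Lipschitz
  (`Convex.norm_image_sub_le_of_norm_hasDerivWithin_le` on `[[d, d']]` for `t ↦ f t − f' d · t`).
* `hasDerivAt_dsigmoid`, `dsigmoid_mem_Icc` (`σ' ∈ [0, ¼]`), **`abs_dsigmoid_sub_dsigmoid_le`**
  (`σ'` is `¼`-Lipschitz), `hasDerivAt_barSummand`, **`abs_barSummand_taylor_le`**
  (`|ψ_{d'} − ψ_d − φ_d (d' − d)| ≤ ½ (d' − d)²`).
* `abs_sampleMean_le` — a sample mean of terms bounded by `B` is bounded by `B`.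
* **`abs_div_add_inv_lt`** — if `ḡ ≠ 0`, `|ḡ + A Δ| ≤ Δ²/2` and `η = |A − κ| + |Δ|/2 < min(κ/2, εκ²/2)`
  then `|Δ/ḡ + 1/κ| < ε`.

Pure real analysis; no measure theory in this file.
-/

namespace Summit.Ventures.LatticeQCDFlow.Exactness.GeneralNCMC

open Set Finset

/-! ## Real-variable lemmas: Taylor with a Lipschitz derivative, the Fermi summand -/

section RealLemmas

/-- **Taylor's bound with a Lipschitz derivative (dimension one).**  If `f` has derivative `f'`
everywhere and `f'` is `L`-Lipschitz (`L ≥ 0`), then `|f d' − f d − f' d (d' − d)| ≤ L (d' − d)²`. -/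
theorem abs_sub_sub_deriv_mul_le {f f' : ℝ → ℝ} {L : ℝ} (hL0 : 0 ≤ L)
    (hf : ∀ t, HasDerivAt f (f' t) t) (hL : ∀ s t, |f' s - f' t| ≤ L * |s - t|) (d d' : ℝ) :
    |f d' - f d - f' d * (d' - d)| ≤ L * (d' - d) ^ 2 := by
  have hh : ∀ t, HasDerivAt (fun t => f t - f' d * t) (f' t - f' d) t := fun t => by
    have h1 : HasDerivAt (fun t => f' d * t) (f' d) t := by
      simpa using (hasDerivAt_id t).const_mul (f' d)
    exact (hf t).fun_sub h1
  have key := (convex_uIcc d d').norm_image_sub_le_of_norm_hasDerivWithin_le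
    (f := fun t => f t - f' d * t) (f' := fun t => f' t - f' d) (C := L * |d' - d|)
    (fun t _ => (hh t).hasDerivWithinAt) (fun t ht => ?_) (left_mem_uIcc) (right_mem_uIcc)
  · rw [Real.norm_eq_abs, Real.norm_eq_abs] at key
    rw [show f d' - f d - f' d * (d' - d) = (f d' - f' d * d') - (f d - f' d * d) by ring]
    calc |(f d' - f' d * d') - (f d - f' d * d)| ≤ L * |d' - d| * |d' - d| := key
      _ = L * (d' - d) ^ 2 := by rw [mul_assoc, ← sq, sq_abs]
  · rw [Real.norm_eq_abs]
    exact (hL t d).trans (mul_le_mul_of_nonneg_left (abs_sub_left_of_mem_uIcc ht) hL0)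

/-- `σ' = σ(1 − σ)` has derivative `σ'(1 − 2σ)`. -/
theorem hasDerivAt_dsigmoid (x : ℝ) :
    HasDerivAt (fun x => Real.sigmoid x * (1 - Real.sigmoid x))
      (Real.sigmoid x * (1 - Real.sigmoid x) * (1 - 2 * Real.sigmoid x)) x := by
  have h := (Real.hasDerivAt_sigmoid x).fun_mul
    ((hasDerivAt_const x (1 : ℝ)).fun_sub (Real.hasDerivAt_sigmoid x))
  exact h.congr_deriv (by ring)

/-- `σ'` lies in `[0, ¼]`. -/
theorem dsigmoid_mem_Icc (x : ℝ) : Real.sigmoid x * (1 - Real.sigmoid x) ∈ Icc (0 : ℝ) (1 / 4) := by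
  have h0 := Real.sigmoid_nonneg x
  have h1 := Real.sigmoid_le_one x
  constructor
  · exact mul_nonneg h0 (by linarith)
  · nlinarith [sq_nonneg (Real.sigmoid x - 1 / 2)]

/-- **`σ'` is `¼`-Lipschitz**: `|σ'(x) − σ'(y)| ≤ ¼ |x − y|` (its derivative `σ'(1 − 2σ)` is bounded
by `¼`). -/
theorem abs_dsigmoid_sub_dsigmoid_le (x y : ℝ) :
    |Real.sigmoid x * (1 - Real.sigmoid x) - Real.sigmoid y * (1 - Real.sigmoid y)| ≤
      1 / 4 * |x - y| := by
  have key := (convex_univ (𝕜 := ℝ) (E := ℝ)).norm_image_sub_le_of_norm_hasDerivWithin_le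
    (f := fun x => Real.sigmoid x * (1 - Real.sigmoid x))
    (f' := fun x => Real.sigmoid x * (1 - Real.sigmoid x) * (1 - 2 * Real.sigmoid x)) (C := 1 / 4)
    (fun t _ => (hasDerivAt_dsigmoid t).hasDerivWithinAt) (fun t _ => ?_) (mem_univ y) (mem_univ x)
  · rwa [Real.norm_eq_abs, Real.norm_eq_abs] at key
  · rw [Real.norm_eq_abs, abs_mul]
    have h01 := dsigmoid_mem_Icc t
    have hb : |1 - 2 * Real.sigmoid t| ≤ 1 := by
      rw [abs_le]
      constructor <;> linarith [Real.sigmoid_nonneg t, Real.sigmoid_le_one t]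
    rw [abs_of_nonneg h01.1]
    calc Real.sigmoid t * (1 - Real.sigmoid t) * |1 - 2 * Real.sigmoid t|
        ≤ 1 / 4 * 1 := mul_le_mul h01.2 hb (abs_nonneg _) (by norm_num)
      _ = 1 / 4 := by norm_num

/-- The one-pair summand `d ↦ σ(d − a) − σ(b − d)` has derivative `σ'(d − a) + σ'(b − d)`. -/
theorem hasDerivAt_barSummand (a b d : ℝ) :
    HasDerivAt (fun d => Real.sigmoid (d - a) - Real.sigmoid (b - d))
      (Real.sigmoid (d - a) * (1 - Real.sigmoid (d - a)) +
        Real.sigmoid (b - d) * (1 - Real.sigmoid (b - d))) d := by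
  have h1 : HasDerivAt (fun d => Real.sigmoid (d - a))
      (Real.sigmoid (d - a) * (1 - Real.sigmoid (d - a))) d := by
    have := (Real.hasDerivAt_sigmoid (d - a)).comp d ((hasDerivAt_id d).sub_const a)
    simpa [Function.comp_def] using this
  have h2 : HasDerivAt (fun d => Real.sigmoid (b - d))
      (-(Real.sigmoid (b - d) * (1 - Real.sigmoid (b - d)))) d := by
    have := (Real.hasDerivAt_sigmoid (b - d)).comp d ((hasDerivAt_const d b).sub (hasDerivAt_id d))
    simpa [Function.comp_def] using this
  exact (h1.fun_sub h2).congr_deriv (by ring)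

/-- **Pointwise Taylor bound for the one-pair summand**:
`|ψ_{d'} − ψ_d − φ_d (d' − d)| ≤ ½ (d' − d)²`. -/
theorem abs_barSummand_taylor_le (a b d d' : ℝ) :
    |(Real.sigmoid (d' - a) - Real.sigmoid (b - d')) - (Real.sigmoid (d - a) - Real.sigmoid (b - d)) -
        (Real.sigmoid (d - a) * (1 - Real.sigmoid (d - a)) +
          Real.sigmoid (b - d) * (1 - Real.sigmoid (b - d))) * (d' - d)| ≤
      1 / 2 * (d' - d) ^ 2 := by
  refine abs_sub_sub_deriv_mul_le (f := fun d => Real.sigmoid (d - a) - Real.sigmoid (b - d))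
    (f' := fun d => Real.sigmoid (d - a) * (1 - Real.sigmoid (d - a)) +
      Real.sigmoid (b - d) * (1 - Real.sigmoid (b - d))) (by norm_num) (hasDerivAt_barSummand a b)
    (fun s t => ?_) d d'
  have h1 := abs_dsigmoid_sub_dsigmoid_le (s - a) (t - a)
  have h2 := abs_dsigmoid_sub_dsigmoid_le (b - s) (b - t)
  rw [show s - a - (t - a) = s - t by ring] at h1
  rw [show b - s - (b - t) = -(s - t) by ring, abs_neg] at h2
  calc |Real.sigmoid (s - a) * (1 - Real.sigmoid (s - a)) + Real.sigmoid (b - s) * (1 - Real.sigmoid (b - s)) -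
          (Real.sigmoid (t - a) * (1 - Real.sigmoid (t - a)) +
            Real.sigmoid (b - t) * (1 - Real.sigmoid (b - t)))|
        = |(Real.sigmoid (s - a) * (1 - Real.sigmoid (s - a)) - Real.sigmoid (t - a) * (1 - Real.sigmoid (t - a))) +
            (Real.sigmoid (b - s) * (1 - Real.sigmoid (b - s)) -
              Real.sigmoid (b - t) * (1 - Real.sigmoid (b - t)))| := by ring_nf
    _ ≤ |Real.sigmoid (s - a) * (1 - Real.sigmoid (s - a)) - Real.sigmoid (t - a) * (1 - Real.sigmoid (t - a))| +
          |Real.sigmoid (b - s) * (1 - Real.sigmoid (b - s)) -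
            Real.sigmoid (b - t) * (1 - Real.sigmoid (b - t))| := abs_add_le _ _
    _ ≤ 1 / 4 * |s - t| + 1 / 4 * |s - t| := add_le_add h1 h2
    _ = 1 / 2 * |s - t| := by ring

/-- A sample mean of terms bounded by `B ≥ 0` in absolute value is bounded by `B`. -/
theorem abs_sampleMean_le {Y : Type*} {F : Y → ℝ} {N : ℕ} {y : Fin N → Y} {B : ℝ} (hB : 0 ≤ B)
    (h : ∀ i, |F (y i)| ≤ B) : |sampleMean F y| ≤ B := by
  unfold sampleMean
  rcases Nat.eq_zero_or_pos N with rfl | hN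
  · simp [hB]
  · have hN' : (0 : ℝ) < N := by exact_mod_cast hN
    rw [abs_div, abs_of_pos hN', div_le_iff₀ hN']
    calc |∑ i, F (y i)| ≤ ∑ i, |F (y i)| := abs_sum_le_sum_abs _ _
      _ ≤ ∑ _i : Fin N, B := sum_le_sum fun i _ => h i
      _ = B * N := by rw [sum_const, Finset.card_univ, Fintype.card_fin, nsmul_eq_mul, mul_comm]

/-- **The real-variable heart of the linearisation.**  If `ḡ ≠ 0`, `|ḡ + A Δ| ≤ Δ²/2`, and
`η = |A − κ| + |Δ|/2` satisfies `η < κ/2` and `η < ε κ²/2` (`κ, ε > 0`), then `|Δ/ḡ + κ⁻¹| < ε`. -/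
theorem abs_div_add_inv_lt {κ A Δ g ε : ℝ} (hκ : 0 < κ) (hε : 0 < ε) (hg : g ≠ 0)
    (hlin : |g + A * Δ| ≤ Δ ^ 2 / 2) (h1 : |A - κ| + |Δ| / 2 < κ / 2)
    (h2 : |A - κ| + |Δ| / 2 < ε * κ ^ 2 / 2) : |Δ / g + κ⁻¹| < ε := by
  set η := |A - κ| + |Δ| / 2 with hη
  have hη0 : 0 ≤ η := by positivity
  have hΔ : Δ ≠ 0 := by
    rintro rfl
    have : |g| ≤ 0 := by simpa using hlin
    exact hg (abs_nonpos_iff.1 this)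
  have hΔpos : 0 < |Δ| := abs_pos.2 hΔ
  -- numerator: `|κ Δ + g| ≤ |Δ| η`
  have hnum : |κ * Δ + g| ≤ |Δ| * η := by
    calc |κ * Δ + g| = |(κ - A) * Δ + (g + A * Δ)| := by ring_nf
      _ ≤ |(κ - A) * Δ| + |g + A * Δ| := abs_add_le _ _
      _ ≤ |A - κ| * |Δ| + Δ ^ 2 / 2 := by rw [abs_mul, abs_sub_comm]; exact add_le_add le_rfl hlin
      _ = |Δ| * η := by rw [hη, ← sq_abs Δ]; ring
  -- denominator: `|Δ| (κ − η) ≤ |g|`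
  have hden : |Δ| * (κ - η) ≤ |g| := by
    have hA : κ - |A - κ| ≤ |A| := by
      have := abs_sub_abs_le_abs_sub κ A
      rw [abs_of_pos hκ, abs_sub_comm] at this
      linarith
    have hAΔ : |A| * |Δ| - Δ ^ 2 / 2 ≤ |g| := by
      have : |A * Δ| ≤ |g + A * Δ| + |g| := by
        calc |A * Δ| = |(g + A * Δ) - g| := by ring_nf
          _ ≤ |g + A * Δ| + |g| := abs_sub _ _
      rw [abs_mul] at this
      linarith
    calc |Δ| * (κ - η) = (κ - |A - κ|) * |Δ| - |Δ| ^ 2 / 2 := by rw [hη]; ring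
      _ ≤ |A| * |Δ| - Δ ^ 2 / 2 := by rw [sq_abs]; nlinarith
      _ ≤ |g| := hAΔ
  have hκη : κ / 2 < κ - η := by linarith
  have hgpos : 0 < |g| := abs_pos.2 hg
  -- the quotient
  have hq : Δ / g + κ⁻¹ = (κ * Δ + g) / (g * κ) := by
    field_simp
  rw [hq, abs_div, abs_mul, abs_of_pos hκ, div_lt_iff₀ (mul_pos hgpos hκ)]
  calc |κ * Δ + g| ≤ |Δ| * η := hnum
    _ < |Δ| * (κ - η) * κ * ε := by
        have : η < (κ - η) * κ * ε := by nlinarith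
        nlinarith
    _ ≤ |g| * κ * ε := by
        have := mul_le_mul_of_nonneg_right (mul_le_mul_of_nonneg_right hden hκ.le) hε.le
        linarith
    _ = ε * (|g| * κ) := by ring

end RealLemmas

end Summit.Ventures.LatticeQCDFlow.Exactness.GeneralNCMC
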